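import Literature.Probability.FitznerVanDerHofstad2017.Stage1FrameRem

/-!
# Literature.Probability.FitznerVanDerHofstad2017.Stage1EvalRem — the rational mirror of the slotted Stage-1 recipe (N68g (g3))

CITATION HEADER (PLACEMENT v2). Part of the certified REPRODUCTION of R. Fitzner, R. van der Hofstad, *Mean-field
behavior for nearest-neighbor percolation in d > 10*, EJP 22 (2017) no. 43 [FvdH17] and *Generalized approach to the
non-backtracking lace expansion*, PTRF 169 (2017) 1041–1119 [NoBLE17]; build `lace`, seat carver (gen 35), node
STAGE1-EVALREM of the what-if census (`carver/g35/D10-KERNEL-CENSUS.md` §3.1).  ADDITIVE companion of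
`Stage1FrameRem.lean` (sha256 00ad3cbfa080287a…) in the pattern of `Stage1Eval.lean` (sha256 ce5b7fe8afe32d72…) /
`Stage1EvalRec.lean` (sha256 f5a526a3768c735e…): nothing there is changed; no numeral, no table, no dimension, no verdict;
nothing here is a cited fact (generator `carver/g35/evalrem/gen_evalrem.py`, mechanical transcription).

WHAT.  `Stage1FrameRem` carries the ten remainder slots `ρ : Fin 10 → T` of `Stage1CellsRem` (D55 rows 1–10) through
the typed frame over `ℝ` (`Data.g13Rm … Data.inpRm ρ`) and proves that at the record reads `ρ := printSlots P` it IS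
the frame of record; its module docstring defers "the rational mirror for a table of certified NBW caps at the slots"
to a later part.  This file is that mirror, GENERIC in the slots: the same definitions verbatim over `ℚ`
(`DataQ.g13Rm`, `DataQ.ob1Rm`, `DataQ.valRm`, `DataQ.evRm` by `PX.evalQ`, the four product lower bounds with the
printed hexagon exponent `K2recQ`, the two cell-37 combinations, `DataQ.muMinRm`, and the sixty App. D inputs
`DataQ.inpRm ρ : Inputs` with real-cast rational fields, field ↦ cell exactly as `Data.inpRm`), and the CAST LEMMAS
at a rational model `D.RatModel E` and a rational state `y : StateQ`: `valRm_ratCast`, `evRm_ratCast` (one lemma for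
every slotted cell at once — the slots are PX syntax, so `PX.eval_ratCast` needs no hypothesis on `ρ`),
`piAlphaLower0Rm_ratCast` … `muMinRm_ratCast`, `inpRm_ratCast : D.inpRm ρ y.cast s = E.inpRm D.P ρ y s`, and the kernel
forms `inpRm_dom_of_ratModel` / `dom_inpRm_of_ratModel` / `uAtRm_of_ratModel` / `evRm_nonneg_of_ratModel` — so that a
two-sided evaluation of the slotted recipe at ANY slot valuation by PX constants (e.g. `ρ r := C a /ₙ b`, a certified
remainder-kernel table in the units of `Stage1CellsRem`) reduces to decidable rational inequalities, exactly as
`MeanFieldD11Stage1EvalRec` does for the recipe of record.  At `ρ := printSlots P` every definition here is the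
corresponding one of `Stage1EvalRec` (`DataQ.inpRm_print`).

[cite: FitznerVanDerHofstad2017, notebook Percolation.nb cells 5, 10, 12, 36–37, 39, 44 (transcript l.237–241, 419–429, 1013–1055, 1214–1237)]
[cite: FitznerVanDerHofstad2016NoBLE, (5.23)–(5.27) and §5.3.2 p. 1097]
-/

namespace Literature.Probability.FitznerVanDerHofstad2017
namespace Stage1Cells

open NoGoFrame F3Bounds BetaMap PX

/-! ## The rational side (verbatim over `ℚ`) -/

namespace DataQ

variable (E : DataQ) (P : Params) (ρ : Fin 10 → T)

/-- `Bound[G,{1},3,s]` of the slotted recipe over `ℚ` (verbatim `Data.g13Rm`). [cite: FitznerVanDerHofstad2017, notebook Percolation.nb cell 5] -/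
noncomputable def g13Rm (s : Pt) (y : StateQ) : ℚ := E.ev0 P s y (Rem.G13 P ρ)

/-- `Bound[OpenBubble,1,s]` of the slotted recipe over `ℚ` (verbatim `Data.ob1Rm`). [cite: FitznerVanDerHofstad2017, notebook Percolation.nb cell 12] -/
noncomputable def ob1Rm (s : Pt) (y : StateQ) : ℚ := E.ev0 P s y (Rem.openBubble P ρ 1 0)

/-- the FULL rational valuation of the slotted recipe (verbatim `Data.valRm`). [cite: FitznerVanDerHofstad2017, notebook Percolation.nb cells 10, 39] -/
noncomputable def valRm (s : Pt) (y : StateQ) : Atom → ℚ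
  | .G13at t => E.g13Rm P ρ t y
  | .mubOverMu => 1 / (1 - E.g13Rm P ρ s y)
  | .mubOverMuI => 1 / (1 - E.g13Rm P ρ .i y)
  | .hdInv => 1 / (1 - E.ob1Rm P ρ s y)
  | a => E.val0 P s y a

/-- evaluation of a cell at rational data under the slotted valuation (verbatim `Data.evRm`, by `PX.evalQ`). [cite: FitznerVanDerHofstad2017, notebook Percolation.nb cells 3–44] -/
noncomputable def evRm (s : Pt) (y : StateQ) (e : T) : ℚ := evalQ (E.valRm P ρ s y) (E.tabs.val P.d) e

/-- cell 36 `Bound[Pi,alpha,lower,0,s]` of the slotted recipe with the PRINTED hexagon exponent, over `ℚ` (verbatim `Data.piAlphaLower0Rm`).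
[cite: FitznerVanDerHofstad2017, notebook Percolation.nb cell 36 (transcript l.1013–1026); extended version arXiv:1506.07977v1 Lemma 5.3] -/
noncomputable def piAlphaLower0Rm (s : Pt) (y : StateQ) : ℚ :=
  K1Q P - E.evRm P ρ s y (Rem.piAlphaLowSub P ρ) + K2recQ P * (1 - E.evRm P ρ s y (Rem.piAlphaLowBr P ρ))

/-- cell 36 `Bound[Psi,lower,0,s]` of the slotted recipe over `ℚ` (verbatim `Data.psiLower0Rm`). [cite: FitznerVanDerHofstad2017, notebook Percolation.nb cell 36 (transcript l.1013–1026)] -/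
noncomputable def psiLower0Rm (s : Pt) (y : StateQ) : ℚ :=
  K1Q P - E.evRm P ρ s y (Rem.piAlphaLowSub P ρ) + (2 * dQ P - 2) ^ 2 * zIrQ P ^ 4 * (1 - E.evRm P ρ s y (Rem.psiLowBr1 P ρ))
    - 2 * dQ P * (2 * dQ P - 2) * zIrQ P ^ 4 * E.evRm P ρ s y (vartheta P) + K3Q P * (1 - E.evRm P ρ s y (Rem.psiLowBr2 P ρ))

/-- cell 36 `Bound[Pi,1,Lower,s]` of the slotted recipe over `ℚ` (verbatim `Data.pi1LowerRm`). [cite: FitznerVanDerHofstad2017, notebook Percolation.nb cell 36 (transcript l.1013–1026)] -/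
noncomputable def pi1LowerRm (s : Pt) (y : StateQ) : ℚ :=
  (2 * dQ P - 1) * (2 * dQ P - 2) * zIrQ P ^ 5 * (1 - E.evRm P ρ s y (Rem.pi1Br0 P ρ))
    - (2 * dQ P - 2) * zIrQ P ^ 5 * E.evRm P ρ s y (Rem.pi1T2 P ρ)
    + K4Q P * ((1 - E.evRm P ρ s y (Rem.pi1Br3a P ρ)) * (1 - E.evRm P ρ s y (Rem.pi1Br3b P ρ)))
    + K4Q P * ((1 - E.evRm P ρ s y (Rem.pi1Br4a P ρ)) * (1 - E.evRm P ρ s y (Rem.pi1Br4b P ρ)))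
    + K5Q P * ((1 - E.evRm P ρ s y (Rem.pi1Br5a P ρ)) * (1 - E.evRm P ρ s y (Rem.pi1Br5b P ρ)))

/-- cell 37 `Bound[Psi,alphaI,0−1,AroundEi,s]` of the slotted recipe over `ℚ` (verbatim `Data.psiAlphaI01Rm`). [cite: FitznerVanDerHofstad2017, notebook Percolation.nb cell 37 (transcript l.1035–1055)] -/
noncomputable def psiAlphaI01Rm (s : Pt) (y : StateQ) : ℚ :=
  E.evRm P ρ s y (Rem.PsiAlphaI01main P ρ)
    + E.evRm P ρ s y (PsiAlphaI01coef P) * (1 - 2 * ((1 - E.evRm P ρ s y (Rem.PsiAlphaI01brA P ρ)) * (1 - E.evRm P ρ s y (Rem.PsiAlphaI01brB P ρ))))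

/-- cell 37 `Bound[Psi,alphaII,0−1,AroundZero,s]` of the slotted recipe over `ℚ` (verbatim `Data.psiAlphaII01Rm`). [cite: FitznerVanDerHofstad2017, notebook Percolation.nb cell 37 (transcript l.1035–1055)] -/
noncomputable def psiAlphaII01Rm (s : Pt) (y : StateQ) : ℚ :=
  E.evRm P ρ s y (Rem.PsiAlphaII01main P ρ)
    + E.evRm P ρ s y (PsiAlphaII01coef P) * (1 - (1 - E.evRm P ρ s y (Rem.PsiAlphaII01brA P ρ)) * (1 - E.evRm P ρ s y (Rem.PsiAlphaII01brB P ρ)))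

/-- cell 44 `mumin[s]` of the slotted recipe over `ℚ` (verbatim `Data.muMinRm`). [cite: FitznerVanDerHofstad2017, notebook Percolation.nb cell 44 (transcript l.1214–1216)] -/
noncomputable def muMinRm (s : Pt) (y : StateQ) : ℚ := zIrQ P * (1 - max (E.g13Rm P ρ s y) (E.g13Rm P ρ .i y))

/-- CELL 44 OF THE SLOTTED RECIPE AT RATIONAL DATA: the sixty App. D inputs with REAL-CAST RATIONAL FIELDS, field ↦ cell
exactly as `Data.inpRm` (verbatim transcription). [cite: FitznerVanDerHofstad2017, notebook Percolation.nb cell 44 (transcript l.1214–1237)] -/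
noncomputable def inpRm (y : StateQ) (s : Pt) : Inputs where
  mu := ((y.m : ℚ) : ℝ)
  muMin := ((E.muMinRm P ρ s y : ℚ) : ℝ)
  mubOverMu := ((E.evRm P ρ s y mubOverMu : ℚ) : ℝ)
  mub := ((E.evRm P ρ s y z : ℚ) : ℝ)
  xiAlphaOneMinusZeroAtZero := 0
  xiAlphaZeroMinusOneAtZero := 0
  xiAlphaOneMinusZeroAtEi := ((E.evRm P ρ s y (Rem.XiAlpha10 P ρ) : ℚ) : ℝ)
  xiAlphaZeroMinusOneAtEi := ((E.evRm P ρ s y (Rem.XiAlpha01 P ρ) : ℚ) : ℝ)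
  xiIotaAlphaIAtEi := ((E.evRm P ρ s y (Rem.XiIotaAlphaI0 P ρ) : ℚ) : ℝ)
  xiIotaAlphaIIAtZero := ((E.evRm P ρ s y XiIotaAlphaII0 : ℚ) : ℝ)
  xiIotaAlphaISumAroundEi := ((E.evRm P ρ s y (Rem.XiIotaAlphaISum P ρ) : ℚ) : ℝ)
  xiIotaAlphaIISumAroundZero := ((E.evRm P ρ s y (Rem.XiIotaAlphaIISum P ρ) : ℚ) : ℝ)
  psiAlphaIOneMinusZeroAroundEi := ((E.evRm P ρ s y (Rem.PsiAlphaI10 P ρ) : ℚ) : ℝ)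
  psiAlphaIIZeroMinusOneAroundZero := ((E.psiAlphaII01Rm P ρ s y : ℚ) : ℝ)
  psiAlphaIZeroMinusOneAroundEi := ((E.psiAlphaI01Rm P ρ s y : ℚ) : ℝ)
  psiAlphaIIOneMinusZeroAroundZero := ((E.evRm P ρ s y (Rem.PsiAlphaII10 P ρ) : ℚ) : ℝ)
  piAlpha := ((E.evRm P ρ s y (Rem.PiAlpha0 P ρ) : ℚ) : ℝ)
  piAlphaLower := ((E.piAlphaLower0Rm P ρ s y : ℚ) : ℝ)
  piOneLower := ((E.pi1LowerRm P ρ s y : ℚ) : ℝ)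
  psiZeroLower := ((E.psiLower0Rm P ρ s y : ℚ) : ℝ)
  xiAbs := ((E.evRm P ρ s y (Rem.XiAbs P ρ) : ℚ) : ℝ)
  xiOdd := ((E.evRm P ρ s y (Rem.XiOdd P ρ) : ℚ) : ℝ)
  xiEven := ((E.evRm P ρ s y (Rem.XiEven P ρ) : ℚ) : ℝ)
  xiEvenTail := ((E.evRm P ρ s y (Rem.Xi2 P ρ) : ℚ) : ℝ)
  xiOddTail := ((E.evRm P ρ s y (Rem.Xi3 P ρ) : ℚ) : ℝ)
  xiR0 := ((E.evRm P ρ s y (Rem.XiR0 P ρ) : ℚ) : ℝ)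
  xiR1 := ((E.evRm P ρ s y (Rem.XiR1 P ρ) : ℚ) : ℝ)
  xiR0Delta := ((E.evRm P ρ s y (Rem.XiR0D P ρ) : ℚ) : ℝ)
  xiR1Delta := ((E.evRm P ρ s y (Rem.XiR1D P ρ) : ℚ) : ℝ)
  xiDeltaAbs := ((E.evRm P ρ s y (Rem.XiAbsD P ρ) : ℚ) : ℝ)
  xiOddDelta := ((E.evRm P ρ s y (Rem.XiOddD P ρ) : ℚ) : ℝ)
  xiEvenDelta := ((E.evRm P ρ s y (Rem.XiEvenD P ρ) : ℚ) : ℝ)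
  xiOddTailDelta := ((E.evRm P ρ s y (Rem.Xi3D P ρ) : ℚ) : ℝ)
  xiEvenTailDelta := ((E.evRm P ρ s y (Rem.Xi2D P ρ) : ℚ) : ℝ)
  psiRI0 := ((E.evRm P ρ s y (Rem.PsiRI0 P ρ) : ℚ) : ℝ)
  psiRI1 := ((E.evRm P ρ s y (Rem.PsiRI1 P ρ) : ℚ) : ℝ)
  psiRII0 := ((E.evRm P ρ s y (Rem.PsiRII0 P ρ) : ℚ) : ℝ)
  psiRII1 := ((E.evRm P ρ s y (Rem.PsiRII1 P ρ) : ℚ) : ℝ)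
  psiRI0Delta := ((E.evRm P ρ s y (Rem.PsiRI0D P ρ) : ℚ) : ℝ)
  psiRI1Delta := ((E.evRm P ρ s y (Rem.PsiRI1D P ρ) : ℚ) : ℝ)
  psiRII0Delta := ((E.evRm P ρ s y (Rem.PsiRII0D P ρ) : ℚ) : ℝ)
  psiRII1Delta := ((E.evRm P ρ s y (Rem.PsiRII1D P ρ) : ℚ) : ℝ)
  piR0 := ((E.evRm P ρ s y (Rem.PiR0 P ρ) : ℚ) : ℝ)
  piR0DeltaEiEk := ((E.evRm P ρ s y (Rem.PiR0D P ρ) : ℚ) : ℝ)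
  xiIotaAbs := ((E.evRm P ρ s y (Rem.XiIotaAbs P ρ) : ℚ) : ℝ)
  xiIotaOdd := ((E.evRm P ρ s y (Rem.XiIotaOdd P ρ) : ℚ) : ℝ)
  xiIotaEven := ((E.evRm P ρ s y (Rem.XiIotaEven P ρ) : ℚ) : ℝ)
  xiIotaEvenTail := ((E.evRm P ρ s y (Rem.XiIota2 P ρ) : ℚ) : ℝ)
  xiIotaRI0 := ((E.evRm P ρ s y (Rem.XiIotaRI0 P ρ) : ℚ) : ℝ)
  xiIotaRII0 := ((E.evRm P ρ s y (Rem.XiIotaRII0 P ρ) : ℚ) : ℝ)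
  xiIotaDeltaEi := ((E.evRm P ρ s y (Rem.XiIotaAbsDei P ρ) : ℚ) : ℝ)
  xiIotaOddDeltaEi := ((E.evRm P ρ s y (Rem.XiIotaOddDei P ρ) : ℚ) : ℝ)
  xiIotaEvenDeltaEi := ((E.evRm P ρ s y (Rem.XiIotaEvenDei P ρ) : ℚ) : ℝ)
  xiIotaEvenTailDeltaEi := ((E.evRm P ρ s y (Rem.XiIota2Dei P ρ) : ℚ) : ℝ)
  xiIotaDeltaZero := ((E.evRm P ρ s y (Rem.XiIotaAbsD0 P ρ) : ℚ) : ℝ)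
  xiIotaOddDeltaZero := ((E.evRm P ρ s y (Rem.XiIotaOddD0 P ρ) : ℚ) : ℝ)
  xiIotaEvenDeltaZero := ((E.evRm P ρ s y (Rem.XiIotaEvenD0 P ρ) : ℚ) : ℝ)
  xiIotaEvenTailDeltaZero := ((E.evRm P ρ s y (Rem.XiIota2D0 P ρ) : ℚ) : ℝ)
  xiIotaRI0DeltaEi := ((E.evRm P ρ s y (Rem.XiIotaRI0Dei P ρ) : ℚ) : ℝ)
  xiIotaRII0DeltaZero := ((E.evRm P ρ s y (Rem.XiIotaRII0D0 P ρ) : ℚ) : ℝ)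

/-! ### Literal reproduction at the record reads: `ρ := printSlots P` gives back the rational recipe of record -/

/-- at the record reads, `Bound[G,{1},3,s]` of the rational slotted recipe is the record's. [cite: FitznerVanDerHofstad2017, notebook Percolation.nb cell 5 (transcript l.237–241)] -/
@[simp] theorem g13Rm_print (s : Pt) (y : StateQ) : E.g13Rm P (printSlots P) s y = E.g13 P s y := rfl

/-- at the record reads, `Bound[OpenBubble,1,s]` of the rational slotted recipe is the record's. [cite: FitznerVanDerHofstad2017, notebook Percolation.nb cell 12 (transcript l.419–429)] -/
@[simp] theorem ob1Rm_print (s : Pt) (y : StateQ) : E.ob1Rm P (printSlots P) s y = E.ob1 P s y := rfl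

/-- at the record reads, the rational slotted valuation is the rational valuation of record. [cite: FitznerVanDerHofstad2017, notebook Percolation.nb cells 10, 39] -/
@[simp] theorem valRm_print (s : Pt) (y : StateQ) : E.valRm P (printSlots P) s y = E.val P s y := by
  funext a; cases a <;> rfl

/-- at the record reads, rational evaluation under the slotted valuation is rational evaluation of record. [cite: FitznerVanDerHofstad2017, notebook Percolation.nb cells 3–44] -/
@[simp] theorem evRm_print (s : Pt) (y : StateQ) (e : T) : E.evRm P (printSlots P) s y e = E.ev P s y e := by
  unfold evRm; rw [valRm_print]; rfl

/-- at the record reads, cell 36 `Bound[Pi,alpha,lower,0,s]` (printed exponent) over `ℚ` is the record's `DataQ.piAlphaLower0Rec`. [cite: FitznerVanDerHofstad2017, notebook Percolation.nb cell 36 (transcript l.1013–1026)] -/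
@[simp] theorem piAlphaLower0Rm_print (s : Pt) (y : StateQ) : E.piAlphaLower0Rm P (printSlots P) s y = E.piAlphaLower0Rec P s y := by
  simp [piAlphaLower0Rm, piAlphaLower0Rec]

/-- at the record reads, cell 36 `Bound[Psi,lower,0,s]` over `ℚ` is the record's. [cite: FitznerVanDerHofstad2017, notebook Percolation.nb cell 36 (transcript l.1013–1026)] -/
@[simp] theorem psiLower0Rm_print (s : Pt) (y : StateQ) : E.psiLower0Rm P (printSlots P) s y = E.psiLower0 P s y := by
  simp [psiLower0Rm, psiLower0]

/-- at the record reads, cell 36 `Bound[Pi,1,Lower,s]` over `ℚ` is the record's. [cite: FitznerVanDerHofstad2017, notebook Percolation.nb cell 36 (transcript l.1013–1026)] -/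
@[simp] theorem pi1LowerRm_print (s : Pt) (y : StateQ) : E.pi1LowerRm P (printSlots P) s y = E.pi1Lower P s y := by
  simp [pi1LowerRm, pi1Lower]

/-- at the record reads, cell 37 `Bound[Psi,alphaI,0−1,AroundEi,s]` over `ℚ` is the record's. [cite: FitznerVanDerHofstad2017, notebook Percolation.nb cell 37 (transcript l.1035–1055)] -/
@[simp] theorem psiAlphaI01Rm_print (s : Pt) (y : StateQ) : E.psiAlphaI01Rm P (printSlots P) s y = E.psiAlphaI01 P s y := by
  simp [psiAlphaI01Rm, psiAlphaI01]

/-- at the record reads, cell 37 `Bound[Psi,alphaII,0−1,AroundZero,s]` over `ℚ` is the record's. [cite: FitznerVanDerHofstad2017, notebook Percolation.nb cell 37 (transcript l.1035–1055)] -/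
@[simp] theorem psiAlphaII01Rm_print (s : Pt) (y : StateQ) : E.psiAlphaII01Rm P (printSlots P) s y = E.psiAlphaII01 P s y := by
  simp [psiAlphaII01Rm, psiAlphaII01]

/-- at the record reads, cell 44 `mumin[s]` over `ℚ` is the record's. [cite: FitznerVanDerHofstad2017, notebook Percolation.nb cell 44 (transcript l.1214–1237)] -/
@[simp] theorem muMinRm_print (s : Pt) (y : StateQ) : E.muMinRm P (printSlots P) s y = E.muMin P s y := rfl

/-- LITERAL REPRODUCTION: at the record reads the rational slotted App. D inputs ARE the rational inputs of record
`DataQ.inpRrec` (so `MeanFieldD11Stage1EvalRec` is an instance of the evaluation pattern of this file). [cite: FitznerVanDerHofstad2017, notebook Percolation.nb cell 44 (transcript l.1214–1237)] -/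
@[simp] theorem inpRm_print (y : StateQ) (s : Pt) : E.inpRm P (printSlots P) y s = E.inpRrec P y s := by
  simp [inpRm, inpRrec]

end DataQ

/-! ## The cast lemmas -/

namespace Data

variable {ν : Type*} {D : Data ν} {E : DataQ} (h : D.RatModel E) (ρ : Fin 10 → T)
include h

/-- `Bound[G,{1},3,s]` of the slotted recipe is the cast of the rational one. [cite: FitznerVanDerHofstad2017, notebook Percolation.nb cell 5 (transcript l.237–241)] -/
theorem g13Rm_ratCast (s : Pt) (y : StateQ) : D.g13Rm ρ s y.cast = ((E.g13Rm D.P ρ s y : ℚ) : ℝ) := ev0_ratCast h s y _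

/-- `Bound[OpenBubble,1,s]` of the slotted recipe is the cast of the rational one. [cite: FitznerVanDerHofstad2017, notebook Percolation.nb cell 12 (transcript l.419–429)] -/
theorem ob1Rm_ratCast (s : Pt) (y : StateQ) : D.ob1Rm ρ s y.cast = ((E.ob1Rm D.P ρ s y : ℚ) : ℝ) := ev0_ratCast h s y _

/-- the full slotted valuation at a rational state is the cast of the rational one. [cite: FitznerVanDerHofstad2017, notebook Percolation.nb cells 10, 39] -/
theorem valRm_ratCast (s : Pt) (y : StateQ) : D.valRm ρ s y.cast = fun a => ((E.valRm D.P ρ s y a : ℚ) : ℝ) := by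
  funext a
  cases a with
  | G13at t => exact g13Rm_ratCast h ρ t y
  | mubOverMu =>
    show 1 / (1 - D.g13Rm ρ s y.cast) = (((1 / (1 - E.g13Rm D.P ρ s y) : ℚ) : ℝ))
    rw [g13Rm_ratCast h]; push_cast; rfl
  | mubOverMuI =>
    show 1 / (1 - D.g13Rm ρ .i y.cast) = (((1 / (1 - E.g13Rm D.P ρ .i y) : ℚ) : ℝ))
    rw [g13Rm_ratCast h]; push_cast; rfl
  | hdInv =>
    show 1 / (1 - D.ob1Rm ρ s y.cast) = (((1 / (1 - E.ob1Rm D.P ρ s y) : ℚ) : ℝ))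
    rw [ob1Rm_ratCast h]; push_cast; rfl
  | z => exact congrFun (val0_ratCast h s y) .z
  | V => exact congrFun (val0_ratCast h s y) .V
  | cw j => exact congrFun (val0_ratCast h s y) (.cw j)
  | Vo => exact congrFun (val0_ratCast h s y) .Vo

/-- THE CAST LEMMA FOR SLOTTED CELLS: a typed cell at rational data under the slotted valuation has the cast of its
rational value (no hypothesis on the slots `ρ`: they are PX syntax). [cite: FitznerVanDerHofstad2017, notebook Percolation.nb cells 3–44] -/
theorem evRm_ratCast (s : Pt) (y : StateQ) (e : T) : D.evRm ρ s y.cast e = ((E.evRm D.P ρ s y e : ℚ) : ℝ) := by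
  rw [Data.evRm, DataQ.evRm, valRm_ratCast h, tabsVal_ratCast h]; exact eval_ratCast _ _ e

/-- cell 36 `Bound[Pi,alpha,lower,0,s]` (printed exponent) of the slotted recipe is the cast of the rational one. [cite: FitznerVanDerHofstad2017, notebook Percolation.nb cell 36 (transcript l.1013–1026)] -/
theorem piAlphaLower0Rm_ratCast (s : Pt) (y : StateQ) :
    D.piAlphaLower0Rm ρ s y.cast = ((E.piAlphaLower0Rm D.P ρ s y : ℚ) : ℝ) := by
  simp only [Data.piAlphaLower0Rm, DataQ.piAlphaLower0Rm, evRm_ratCast h, K1_ratCast, K2rec_ratCast]; push_cast; all_goals rfl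

/-- cell 36 `Bound[Psi,lower,0,s]` of the slotted recipe is the cast of the rational one. [cite: FitznerVanDerHofstad2017, notebook Percolation.nb cell 36 (transcript l.1013–1026)] -/
theorem psiLower0Rm_ratCast (s : Pt) (y : StateQ) : D.psiLower0Rm ρ s y.cast = ((E.psiLower0Rm D.P ρ s y : ℚ) : ℝ) := by
  simp only [Data.psiLower0Rm, DataQ.psiLower0Rm, evRm_ratCast h, K1_ratCast, K3_ratCast, Data.zIr, zIrQ, Data.dR, dQ]
  push_cast; all_goals rfl

/-- cell 36 `Bound[Pi,1,Lower,s]` of the slotted recipe is the cast of the rational one. [cite: FitznerVanDerHofstad2017, notebook Percolation.nb cell 36 (transcript l.1013–1026)] -/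
theorem pi1LowerRm_ratCast (s : Pt) (y : StateQ) : D.pi1LowerRm ρ s y.cast = ((E.pi1LowerRm D.P ρ s y : ℚ) : ℝ) := by
  simp only [Data.pi1LowerRm, DataQ.pi1LowerRm, evRm_ratCast h, K4_ratCast, K5_ratCast, Data.zIr, zIrQ, Data.dR, dQ]
  push_cast; all_goals rfl

/-- cell 37 `Bound[Psi,alphaI,0−1,AroundEi,s]` of the slotted recipe is the cast of the rational one. [cite: FitznerVanDerHofstad2017, notebook Percolation.nb cell 37 (transcript l.1035–1055)] -/
theorem psiAlphaI01Rm_ratCast (s : Pt) (y : StateQ) :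
    D.psiAlphaI01Rm ρ s y.cast = ((E.psiAlphaI01Rm D.P ρ s y : ℚ) : ℝ) := by
  simp only [Data.psiAlphaI01Rm, DataQ.psiAlphaI01Rm, evRm_ratCast h]; push_cast; all_goals rfl

/-- cell 37 `Bound[Psi,alphaII,0−1,AroundZero,s]` of the slotted recipe is the cast of the rational one. [cite: FitznerVanDerHofstad2017, notebook Percolation.nb cell 37 (transcript l.1035–1055)] -/
theorem psiAlphaII01Rm_ratCast (s : Pt) (y : StateQ) :
    D.psiAlphaII01Rm ρ s y.cast = ((E.psiAlphaII01Rm D.P ρ s y : ℚ) : ℝ) := by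
  simp only [Data.psiAlphaII01Rm, DataQ.psiAlphaII01Rm, evRm_ratCast h]; push_cast; all_goals rfl

/-- cell 44 `mumin[s]` of the slotted recipe is the cast of the rational one. [cite: FitznerVanDerHofstad2017, notebook Percolation.nb cell 44 (transcript l.1214–1237)] -/
theorem muMinRm_ratCast (s : Pt) (y : StateQ) : D.muMinRm ρ s y.cast = ((E.muMinRm D.P ρ s y : ℚ) : ℝ) := by
  simp only [Data.muMinRm, DataQ.muMinRm, g13Rm_ratCast h, zIr_ratCast]; push_cast; all_goals rfl

/-- CELL 44 OF THE SLOTTED RECIPE AT RATIONAL DATA: the typed App. D input record at a rational state is, field by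
field, the cast of its rational value. [cite: FitznerVanDerHofstad2017, notebook Percolation.nb cell 44 (transcript l.1214–1237)] -/
theorem inpRm_ratCast (y : StateQ) (s : Pt) : D.inpRm ρ y.cast s = E.inpRm D.P ρ y s := by
  simp only [Data.inpRm, DataQ.inpRm, evRm_ratCast h, muMinRm_ratCast h, piAlphaLower0Rm_ratCast h, psiLower0Rm_ratCast h,
    pi1LowerRm_ratCast h, psiAlphaI01Rm_ratCast h, psiAlphaII01Rm_ratCast h, StateQ.cast_m]

/-- KERNEL FORM OF AN UPPER COMPARISON for the slotted recipe: the typed record is dominated by `N` as soon as the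
rational record is. [cite: FitznerVanDerHofstad2017, notebook Percolation.nb cell 44 (transcript l.1214–1237)] -/
theorem inpRm_dom_of_ratModel {y : StateQ} {s : Pt} {N : Inputs} (hN : (E.inpRm D.P ρ y s).Dom N) :
    (D.inpRm ρ y.cast s).Dom N := by
  rw [inpRm_ratCast h]; exact hN

/-- kernel form of a lower comparison for the slotted recipe (`N` dominated by the typed record). [cite: FitznerVanDerHofstad2017, notebook Percolation.nb cell 44 (transcript l.1214–1237)] -/
theorem dom_inpRm_of_ratModel {y : StateQ} {s : Pt} {N : Inputs} (hN : N.Dom (E.inpRm D.P ρ y s)) :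
    N.Dom (D.inpRm ρ y.cast s) := by
  rw [inpRm_ratCast h]; exact hN

/-- KERNEL FORM OF THE SLOTTED VALIDITY CONDITIONS `Data.UAtRm` at a rational state: seven decidable rational
inequalities. [cite: FitznerVanDerHofstad2017, notebook Percolation.nb cell 44 (transcript l.1214–1237)] -/
theorem uAtRm_of_ratModel {y : StateQ} {s : Pt} (hg : E.g13Rm D.P ρ s y < 1) (hob : E.ob1Rm D.P ρ s y < 1)
    (h3a : E.evRm D.P ρ s y (Rem.pi1Br3a D.P ρ) ≤ 1) (h5a : E.evRm D.P ρ s y (Rem.pi1Br5a D.P ρ) ≤ 1)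
    (h5b : E.evRm D.P ρ s y (Rem.pi1Br5b D.P ρ) ≤ 1) (hA : E.evRm D.P ρ s y (Rem.PsiAlphaII01brA D.P ρ) ≤ 1)
    (hB : E.evRm D.P ρ s y (Rem.PsiAlphaII01brB D.P ρ) ≤ 1) : D.UAtRm ρ s y.cast where
  g13 := by rw [g13Rm_ratCast h]; exact_mod_cast hg
  ob1 := by rw [ob1Rm_ratCast h]; exact_mod_cast hob
  br3a := by rw [evRm_ratCast h]; exact_mod_cast h3a
  br5a := by rw [evRm_ratCast h]; exact_mod_cast h5a
  br5b := by rw [evRm_ratCast h]; exact_mod_cast h5b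
  brIIA := by rw [evRm_ratCast h]; exact_mod_cast hA
  brIIB := by rw [evRm_ratCast h]; exact_mod_cast hB

/-- every slotted cell is `≥ 0` at a rational state as soon as its rational value is. [cite: FitznerVanDerHofstad2017, notebook Percolation.nb cells 3–44] -/
theorem evRm_nonneg_of_ratModel {y : StateQ} {s : Pt} {e : T} (he : 0 ≤ E.evRm D.P ρ s y e) : 0 ≤ D.evRm ρ s y.cast e := by
  rw [evRm_ratCast h]; exact_mod_cast he

end Data

end Stage1Cells
end Literature.Probability.FitznerVanDerHofstad2017
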